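import Mathlib.Topology.Algebra.Group.Quotient
import Literature.AnabelianGeometry.Anabelioids.ProSigma
import Literature.AnabelianGeometry.SemiGraphs.TemperedSpecialFibreReductions
import HarnessLib

/-!
# [SemiAnbd] Cor. 3.11, proof step (S2) «`p_α = p_β`»: the GROUP-THEORETIC cut — `J_Σ(Δ′)`, the level
# vertex groups and the inertia groups `I_v ⊆ D_v ⊆ Δ[□]/Δ′[□]`, intrinsically; the two geometric
# sentences (S2a), (S2b) of the printed proof (statements)

Mochizuki, *Semi-graphs of anabelioids*, Publ. RIMS **42** (2006), §3, Corollary 3.11, proof, manuscript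
p. 46 l. 1–14, p. 47 (i), p. 48 l. 9–24 [cite: MochizukiSemiAnbd2006, Cor 3.11 pp.46-48]:

> "Let `Σ` be a set of prime numbers such that `p_α, p_β ∉ Σ`. … the kernel `I_Σ[□] := Ker(Δ[□] ↠ Δ[□]_Σ)`
> may be recovered as the kernel `J_Σ[□]` of the natural morphism `Δ[□] → Δ̂[□]^Σ` …" (p. 46)
> "(i) The technique … may also be applied to open subgroups of finite index … that correspond via `γ`."
> (p. 47) "Next, let us observe that, if `Δ′[α] ⊆ Δ[α]`, `Δ′[β] ⊆ Δ[β]` are normal open subgroups of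
> finite index that correspond via `γ`, and we write `G′[□]` … for the corresponding … graphs of
> anabelioids, then the decomposition group `D_v ⊆ Δ[□]/Δ′[□]` determined by a vertex `v` of `G′[□]` acts
> naturally on the anabelioid `G′[□]^Σ_v` [i.e., the pro-`Σ` completion of the anabelioid `G′[□]_v`].
> Thus, the inertia group `I_v ⊆ D_v` at `v` — i.e., the subgroup that acts trivially on this anabelioid —
> is necessarily of order a power of `p_□`. (Indeed, here we use the easily verified fact that any
> nontrivial automorphism of an irreducible component of the special fiber … induces a nontrivial outer
> automorphism of the tame pro-`Σ` fundamental group …) In particular, [since there exist `Δ′[□]` for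
> which `I_v` is nontrivial — cf., e.g., the proof of assertion (iv) given above] we obtain that
> `p_α = p_β`." (p. 48)

STATEMENTS file (abc-iut cell, layer L3, sub-DAG `plan/L3/SUBDAG-SemiAnbd-Cor311.md` row S2 =
`ResidueCharOfTemperedIso`, FACT-LIST F-1725, `TemperedSpecialFibreReductions.lean` — whose universal
closure over the origin parameter is refuted in `TemperedSpecialFibreReductionsSchema.lean`, so the step is
meaningful only at genuine origins; seat abc-iut-L3-t11 gen 4, L3-lead ruling α106 «Cor311·S2»).  The
printed step is a GROUP-THEORETIC TRANSPORT plus two geometric sentences; this file types the objects the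
transport acts on INTRINSICALLY in the topological group `Δ = Δ[□]` — so that "correspond via `γ`" is a
theorem (proof-only sequel `TemperedSpecialFibreInertiaTransport.lean`), not a hypothesis — and the two
geometric sentences as origin-parametrised named steps (FACT-policy, like (S1), (S3′), (C)):

* `sigmaFiniteResidual Σ Δ′` — print's `J_Σ` at the level `Δ′` (p. 46, with (i) p. 47): the elements of
  `Δ′` in every open subgroup `W ⊆ Δ′` normalised by `Δ′` with `[Δ′ : W]` a `Σ`-integer, i.e.
  `Ker(Δ′ → Δ̂′^Σ)`; print identifies `Δ′/J_Σ = Δ′[□]_Σ ≅ π₁^temp(G′[□]_Σ)` (p. 46 — step (S1); NOT used or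
  asserted here);
* `levelInertia Δ′ J H` — "the inertia group `I_v ⊆ D_v` … the subgroup that acts trivially on this
  anabelioid" (p. 48 l. 13–14): the `d ∈ Δ` whose conjugation on `H/J` agrees with conjugation by an
  element of `Δ′` — i.e. `d` stabilises the `Δ′`-conjugacy class of `H/J` (lies over `D_v`) and induces the
  TRIVIAL OUTER automorphism of it; a subgroup of `Δ` containing `Δ′`, `I_v = levelInertia/Δ′`, so "the
  order of `I_v`" is `Δ′.relIndex (levelInertia Δ′ J H)`;
* `IsLevelVertexGroup Σ Δ′ H` — "`H/J_Σ` is a MAXIMAL COMPACT subgroup of `Δ′/J_Σ`": under (S1) and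
  Thm. 3.7 (iv) at the FINITE graph `G′[□]_Σ` (a tree theorem at finite graphs) these are the vertex groups
  `π̂₁(G′[□]_v)^Σ` = the fundamental groups of "the anabelioid `G′[□]^Σ_v`" (p. 48 l. 12–13);
* (S2a) `InertiaOrdersPrimePow Σ p Ω` — "the inertia group … is necessarily of order a power of `p_□`"
  (p. 48 l. 13–15; print's ground: tame pro-`Σ` `π₁` rigidity of components, l. 15–21);
* (S2b) `HasNontrivialInertia Σ Ω` — "there exist `Δ′[□]` for which `I_v` is nontrivial" (p. 48 l. 22–23);
The sequel PROVES the transport and «(S2) ⇐ (S2a at `Ω_α`, `Ω_β`) ∧ (S2b at `Ω_α`)»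
(`residueCharOfTemperedIso_of_inertia`); the consumer chooses `Σ` with `p_α, p_β ∉ Σ` (p. 46 l. 1 of the
proof).  No instance, no notation; no statement of `TemperedSpecialFibre(Reductions).lean` is altered;
(S2a)/(S2b) are typed, not proved, asserted for no origin; nothing here takes a side on [IUTchIII]
Cor. 3.12.
-/

noncomputable section

namespace Literature.AnabelianGeometry.SemiGraphs

open Topology
open Literature.AnabelianGeometry.Anabelioids (IsSigmaInteger)

universe u

/-! ### `J_Σ(Δ′)`: the kernel of `Δ′ → Δ̂′^Σ` (p. 46), intrinsically -/

section SigmaResidual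

variable {Δ : Type u} [Group Δ] [TopologicalSpace Δ]

/-- The family of subgroups whose intersection is `J_Σ(Δ′)`: the OPEN subgroups `W ⊆ Δ′` normalised by
`Δ′` whose index `[Δ′ : W]` is a `Σ`-integer ("Galois coverings of degree a `Σ`-integer", p. 46 l. 5; the
profinite completion of a topological group is taken with respect to its open subgroups of finite index,
§0). [cite: MochizukiSemiAnbd2006, Cor 3.11 p.46] -/
def sigmaFiniteFamily (S : Set ℕ) (N : Subgroup Δ) : Set (Subgroup Δ) :=
  {W | W ≤ N ∧ IsOpen (W : Set Δ) ∧ (∀ n ∈ N, ∀ w ∈ W, n * w * n⁻¹ ∈ W) ∧ IsSigmaInteger S (W.relIndex N)}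

/-- **`J_Σ(Δ′)`** ([SemiAnbd] Cor. 3.11, proof, p. 46 l. 9–14: "the kernel `J_Σ[□]` of the natural morphism
`Δ[□] → Δ̂[□]^Σ`", at the level of an open subgroup `Δ′` per (i) p. 47): the elements of `Δ′` lying in
every open subgroup `W ⊆ Δ′` normalised by `Δ′` of `Σ`-integer index — an INTRINSIC subgroup of the
topological group `Δ`. Print: `J_Σ = I_Σ := Ker(Δ′ ↠ Δ′_Σ)`, the kernel of the pro-`Σ` admissible quotient
(p. 46 l. 9–14, via "free discrete groups inject into their pro-`Σ` completions", Rmk. 1.7.1) — that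
identification is step (S1) and is not used here. [cite: MochizukiSemiAnbd2006, Cor 3.11 p.46] -/
def sigmaFiniteResidual (S : Set ℕ) (N : Subgroup Δ) : Subgroup Δ :=
  N ⊓ sInf (sigmaFiniteFamily S N)

end SigmaResidual

/-! ### The inertia subgroup `I_v` (p. 48), intrinsically -/

section Inertia

variable {Δ : Type u} [Group Δ]

/-- **The inertia group `I_v ⊆ D_v`**, as a subgroup of `Δ` containing `Δ′` ([SemiAnbd] Cor. 3.11,
proof, p. 48 l. 9–14: "the decomposition group `D_v ⊆ Δ[□]/Δ′[□]` determined by a vertex `v` of `G′[□]`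
acts naturally on the anabelioid `G′[□]^Σ_v` … the inertia group `I_v ⊆ D_v` at `v` — i.e., the subgroup
that acts trivially on this anabelioid"): for subgroups `Δ′ = N`, `J ⊴ Δ` and `H` (playing
`π̂₁(G′[□]_v)^Σ ⊆ Δ′/J`, read through its preimage), the subgroup `Δ′ · C` where `C` consists of the `d ∈ Δ`
centralising `H` modulo `J` — i.e. (for `Δ′ ⊴ Δ`, `mem_levelInertia_iff` of the sequel) the `d ∈ Δ` whose
conjugation action on `H/J` COINCIDES with conjugation by some element of `Δ′`: `d` stabilises the
`Δ′`-conjugacy class of the vertex group (`d ↦ D_v`) and induces the trivial OUTER automorphism of it (an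
action on a connected anabelioid is trivial iff the outer automorphism is, §1).  It contains `Δ′`; `I_v`
is its image in `Δ[□]/Δ′[□]`, of order `Δ′.relIndex (levelInertia Δ′ J H)`.
[cite: MochizukiSemiAnbd2006, Cor 3.11 p.48] -/
def levelInertia (N J : Subgroup Δ) [hJ : J.Normal] (H : Subgroup Δ) : Subgroup Δ :=
  N ⊔ (Subgroup.centralizer ((QuotientGroup.mk' J) '' (H : Set Δ))).comap (QuotientGroup.mk' J)

end Inertia

/-! ### The level vertex groups: maximal compact subgroups of `Δ′/J_Σ` (pp. 40, 48) -/

section Vertex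

variable {Δ : Type u} [Group Δ] [TopologicalSpace Δ]

/-- **A vertex group at the level `Δ′`** ("a vertex `v` of `G′[□]` … the anabelioid `G′[□]^Σ_v` [i.e., the
pro-`Σ` completion of the anabelioid `G′[□]_v`]", p. 48 l. 10–13), INTRINSICALLY: a subgroup
`J_Σ(Δ′) ⊆ H ⊆ Δ′` whose image `H/J_Σ` in `Δ/J_Σ` is COMPACT and MAXIMAL among the compact images of such
subgroups — under the identification `Δ′/J_Σ ≅ π₁^temp(G′[□]_Σ)` (p. 46, step (S1)) and Thm. 3.7 (iv) at
the finite graph `G′[□]_Σ` ("the maximal compact subgroups of `π₁^temp(𝒢)` are precisely the verticial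
subgroups", p. 40) these are the vertex groups `π̂₁(G′[□]_v)^Σ`; that identification is FACT-policy and is
neither used nor asserted here. [cite: MochizukiSemiAnbd2006, Cor 3.11 p.48] -/
def IsLevelVertexGroup (S : Set ℕ) (N H : Subgroup Δ) : Prop :=
  sigmaFiniteResidual S N ≤ H ∧ H ≤ N ∧
    IsCompact ((QuotientGroup.mk : Δ → Δ ⧸ sigmaFiniteResidual S N) '' (H : Set Δ)) ∧
    ∀ H' : Subgroup Δ, sigmaFiniteResidual S N ≤ H' → H' ≤ N →
      IsCompact ((QuotientGroup.mk : Δ → Δ ⧸ sigmaFiniteResidual S N) '' (H' : Set Δ)) →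
      H ≤ H' → H' = H

end Vertex

/-! ### The two geometric sentences of p. 48 as origin-parametrised named steps (S2a), (S2b) -/

section Steps

variable {K : Type u} [Field K]

/-- (S2a) **"the inertia group `I_v ⊆ D_v` at `v` … is necessarily of order a power of `p_□`"** ([SemiAnbd]
Cor. 3.11, proof, p. 48 l. 13–15; print's ground, l. 15–21: "any nontrivial automorphism of an irreducible
component of the special fiber [of the stable model of the covering determined by `Δ′[□]`] induces a
nontrivial outer automorphism of the tame pro-`Σ` fundamental group … of the open subscheme of this
irreducible component given by taking the complement … of the nodes and cusps"), as a named residual step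
over the origin hypothesis (FACT-policy: stable models of the coverings and tame fundamental groups of
their components are not constructed in the tree; assumed by consumers at a genuine origin, asserted for
no instance), with the inertia groups in their INTRINSIC form: for THE geometric tempered fundamental
group `Δ` of a curve over (a finite extension of) `ℚ_p`, every normal open subgroup of finite index
`Δ′ ⊴ Δ` and every level vertex group `H` (a maximal compact subgroup of `Δ′/J_Σ`), the order
`[levelInertia Δ′ J_Σ H : Δ′]` of `I_v` is a power of `p` (the binder `hJ`, the normality of `J_Σ(Δ′)`
in `Δ`, is a THEOREM — `sigmaFiniteResidual_normal` of the proof-only sequel — carried as a binder only so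
that this statements file needs no proof).  Print's proviso "`p_α, p_β ∉ Σ`" (p. 46 l. 1)
is the consumer's choice of `Σ`. [cite: MochizukiSemiAnbd2006, Cor 3.11 p.48] -/
def InertiaOrdersPrimePow (S : Set ℕ) (p : ℕ) (Ω : SpecialFibreOrigin K) : Prop :=
  ∀ (D : TemperedArithmeticGroup K) (Sp : SpecialFibreData D), Ω.IsSpecialFibreOf D Sp →
    ∀ (N : Subgroup D.delta) (hJ : (sigmaFiniteResidual S N).Normal), N.Normal →
      IsOpen (N : Set D.delta) → N.FiniteIndex →
      ∀ H : Subgroup D.delta, IsLevelVertexGroup S N H →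
        ∃ k : ℕ, N.relIndex (levelInertia (hJ := hJ) N (sigmaFiniteResidual S N) H) = p ^ k

/-- (S2b) **"there exist `Δ′[□]` for which `I_v` is nontrivial — cf., e.g., the proof of assertion (iv)"**
([SemiAnbd] Cor. 3.11, proof, p. 48 l. 22–23; (iv) p. 47: finite étale coverings of the curve "ramified
over the irreducible component"), as a named residual step over the origin hypothesis (FACT-policy;
assumed by consumers at a genuine origin, asserted for no instance): for THE geometric tempered fundamental
group `Δ` of the curve there are a normal open subgroup of finite index `Δ′ ⊴ Δ` and a level vertex group
`H` at `Δ′` whose inertia group `I_v = levelInertia/Δ′` is NONTRIVIAL.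
[cite: MochizukiSemiAnbd2006, Cor 3.11 p.48] -/
def HasNontrivialInertia (S : Set ℕ) (Ω : SpecialFibreOrigin K) : Prop :=
  ∀ (D : TemperedArithmeticGroup K) (Sp : SpecialFibreData D), Ω.IsSpecialFibreOf D Sp →
    ∃ (N : Subgroup D.delta) (hJ : (sigmaFiniteResidual S N).Normal), N.Normal ∧
      IsOpen (N : Set D.delta) ∧ N.FiniteIndex ∧
      ∃ H : Subgroup D.delta, IsLevelVertexGroup S N H ∧
        N.relIndex (levelInertia (hJ := hJ) N (sigmaFiniteResidual S N) H) ≠ 1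

end Steps

end Literature.AnabelianGeometry.SemiGraphs

end
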